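import Summits.RiemannHypothesis.RiemannHypothesis.Theorems.PfPersistenceJointReaders
import HarnessLib

/-!
# PF persistence — TWO-WINDOW STEP (TRANSPORT) READERS, typed: PF-C4's excited-ratio clause and its kin
(pub-rhpf barrier-typer gen 5; pf g3 14:33Z row PF-C4; MEMBERSHIP.md Gen-5 addendum)

**HONEST FRAMING. This is a long-odds MECHANISM SEARCH; no RH claims.** RH-free. PF-C4 reads a CROSS-WINDOW
quantity — the step `Δ_ratio(w) = lg(e₂⁺/o₁⁻)(w + h) − lg(e₂⁺/o₁⁻)(w)` of served spectral fields between two consecutive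
windows `(w, N)`, `(w + h, N)` — and asks it to lie in a band.  Such a clause is not a per-window product (so not
literally a `sectorLookAheadClassAt` member), but it is decided by the sector data at the two windows, hence
`SectorFinitelyDetermined`, hence inside the locality barrier W1.  This file types the shape once, for every joint
predicate of the two blocks, in the multi-sector setting of `PfPersistenceSectorLocality` / `PfPersistenceJointReaders`:

* `sectorStepReaderAt win h hh P` — membership decided by a joint predicate `P` of the sector blocks at `win` and at its
  look-ahead `win.lookAhead h hh 1 = (win.a + h, win.N)` (PF-C4: `P` = LADDER at both ∧ `|Δ_ratio − Δ^ζ| ≤ 0.5`);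
  `sectorStepReaderOn G h hh P` — the same clause imposed at every anchor of a finite served set `G`.
* `sectorStepReaderAt_finitelyDetermined`, `sectorStepReaderOn_finitelyDetermined` — decided by two (resp. `2|G|`)
  windows.
* `not_sectorSeparates_sectorStepReaderAt` / `…On` — **closed-global (THEOREM, RH-free):** on any domain containing the
  prime dials of `ζ`, no such reader separates `ζ`'s sector datum from the detectably negative members (witness: an
  even-sector prime dial beyond the reach of both windows — identical blocks at both, so identical step, negative at its
  own window).  What PF-C4 does on the served pairs (kills the C8-N3 twin by −2.1 dex) is DATA and untouched by this.
-/

set_option linter.dupNamespace false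

noncomputable section

open Real Set Matrix

namespace Summit.RiemannHypothesis.RiemannHypothesis.Theorems.PfPersistence

/-- **TYPED — TWO-WINDOW STEP READER at an anchor:** `d ∈ S ⇔ P (d win) (d (win + h))`, `P` any joint predicate of
the sector blocks at the anchor and at its one-step look-ahead (same truncation `N`). -/
def sectorStepReaderAt {ι : Type} (win : Window) (h : ℝ) (hh : 0 ≤ h)
    (P : (ι → Matrix (Fin (win.N + 1)) (Fin (win.N + 1)) ℝ) →
      (ι → Matrix (Fin ((win.lookAhead h hh 1).N + 1)) (Fin ((win.lookAhead h hh 1).N + 1)) ℝ) → Prop) :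
    Set (SectorDatum ι) :=
  {d | P (d win) (d (win.lookAhead h hh 1))}

/-- **TYPED — the step clause at every anchor of a finite served set `G`** (one predicate per anchor). -/
def sectorStepReaderOn {ι : Type} (G : Finset Window) (h : ℝ) (hh : 0 ≤ h)
    (P : (win : Window) → (ι → Matrix (Fin (win.N + 1)) (Fin (win.N + 1)) ℝ) →
      (ι → Matrix (Fin ((win.lookAhead h hh 1).N + 1)) (Fin ((win.lookAhead h hh 1).N + 1)) ℝ) → Prop) :
    Set (SectorDatum ι) :=
  {d | ∀ win ∈ G, d ∈ sectorStepReaderAt win h hh (P win)}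

/-- PROVED: a step reader is decided by its two windows. [folklore] -/
theorem sectorStepReaderAt_finitelyDetermined {ι : Type} (win : Window) (h : ℝ) (hh : 0 ≤ h)
    (P : (ι → Matrix (Fin (win.N + 1)) (Fin (win.N + 1)) ℝ) →
      (ι → Matrix (Fin ((win.lookAhead h hh 1).N + 1)) (Fin ((win.lookAhead h hh 1).N + 1)) ℝ) → Prop) :
    SectorFinitelyDetermined (sectorStepReaderAt win h hh P) := by
  classical
  refine ⟨{win, win.lookAhead h hh 1}, fun d d' hdd' => ?_⟩
  simp only [sectorStepReaderAt, mem_setOf_eq]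
  rw [hdd' win (by simp), hdd' (win.lookAhead h hh 1) (by simp)]

/-- PROVED: the clause on a finite anchor set is decided by finitely many windows. [folklore] -/
theorem sectorStepReaderOn_finitelyDetermined {ι : Type} (G : Finset Window) (h : ℝ) (hh : 0 ≤ h)
    (P : (win : Window) → (ι → Matrix (Fin (win.N + 1)) (Fin (win.N + 1)) ℝ) →
      (ι → Matrix (Fin ((win.lookAhead h hh 1).N + 1)) (Fin ((win.lookAhead h hh 1).N + 1)) ℝ) → Prop) :
    SectorFinitelyDetermined (sectorStepReaderOn G h hh P) := by
  classical
  refine ⟨G ∪ G.image fun win => win.lookAhead h hh 1, fun d d' hdd' => ?_⟩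
  simp only [sectorStepReaderOn, sectorStepReaderAt, mem_setOf_eq]
  refine forall₂_congr fun win hwin => ?_
  rw [hdd' win (Finset.mem_union_left _ hwin),
    hdd' (win.lookAhead h hh 1) (Finset.mem_union_right _ (Finset.mem_image_of_mem _ hwin))]

/-- **PROVED — CLOSED-GLOBAL (RH-free):** no two-window step reader separates `ζ`'s sector datum from the detectably
negative members of a domain containing the prime dials of `ζ`. [folklore] -/
theorem not_sectorSeparates_sectorStepReaderAt {ι : Type} {Θs : ι → ℝ → ℕ → ℕ → ℝ → ℝ} {i₀ : ι}
    (hΘ : Θs i₀ = thetaEven) (win : Window) (h : ℝ) (hh : 0 ≤ h)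
    (P : (ι → Matrix (Fin (win.N + 1)) (Fin (win.N + 1)) ℝ) →
      (ι → Matrix (Fin ((win.lookAhead h hh 1).N + 1)) (Fin ((win.lookAhead h hh 1).N + 1)) ℝ) → Prop)
    {Dm : Set (SectorDatum ι)} (hD : ∀ (p : ℕ) (K : ℝ), p.Prime → sectorDatumOf Θs (dial p K zetaWeights) ∈ Dm) :
    ¬ SectorSeparates (sectorStepReaderAt win h hh P) Dm (sectorDatumOf Θs zetaWeights) :=
  not_sectorSeparates_of_sectorFinitelyDetermined hΘ hD (sectorStepReaderAt_finitelyDetermined win h hh P)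

/-- **PROVED — CLOSED-GLOBAL on every finite anchor set (RH-free).** [folklore] -/
theorem not_sectorSeparates_sectorStepReaderOn {ι : Type} {Θs : ι → ℝ → ℕ → ℕ → ℝ → ℝ} {i₀ : ι}
    (hΘ : Θs i₀ = thetaEven) (G : Finset Window) (h : ℝ) (hh : 0 ≤ h)
    (P : (win : Window) → (ι → Matrix (Fin (win.N + 1)) (Fin (win.N + 1)) ℝ) →
      (ι → Matrix (Fin ((win.lookAhead h hh 1).N + 1)) (Fin ((win.lookAhead h hh 1).N + 1)) ℝ) → Prop)
    {Dm : Set (SectorDatum ι)} (hD : ∀ (p : ℕ) (K : ℝ), p.Prime → sectorDatumOf Θs (dial p K zetaWeights) ∈ Dm) :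
    ¬ SectorSeparates (sectorStepReaderOn G h hh P) Dm (sectorDatumOf Θs zetaWeights) :=
  not_sectorSeparates_of_sectorFinitelyDetermined hΘ hD (sectorStepReaderOn_finitelyDetermined G h hh P)

end Summit.RiemannHypothesis.RiemannHypothesis.Theorems.PfPersistence

end
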